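import Mathlib

/-!
# (P1) Determinant pigeonhole for symmetric subsets of `GL₂(K)`
# (crux `LevelGradedCohnUmans.GradedDesignFamily`, stmt-MatrixMultiplication-7610; negative side,
# line `quadratic-extension-level-one-cell`, unit b2b-lgcu-subfield gen 18)

HONEST FRAMING.  This proves piece (P1) of `structureDichotomy_of_pieces`
(`Negative/SubfieldCellStructure.lean`) verbatim: for a non-empty symmetric `A ⊆ GL₂(K)`,
`|A| ≤ (|K| − 1) · |A² ∩ SL₂(K)|` — the largest determinant fibre of `A`, translated by the inverse
of one of its elements, lies in `A² ∩ SL₂`.  One elementary input of the Lean reduction of `¬S3`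
(THEOREM F′); NOT summit progress.

Sorry-free. [folklore]
-/

set_option linter.dupNamespace false

open scoped Pointwise

namespace Summit.MatrixMultiplication.MatrixMultiplication.Theorems.GradedDesignFamily.Negative

/-- **(P1) determinant pigeonhole**: `|A| ≤ (|K| − 1)·|A² ∩ SL₂(K)|` for non-empty symmetric
`A ⊆ GL₂(K)`.  Hypothesis (P1) of `structureDichotomy_of_pieces`, verbatim.  NOT summit progress.
[folklore] -/
theorem subfieldCell_detPigeonhole (K : Type) [Field K] [Fintype K] [DecidableEq K]
    (A : Finset (Matrix.GeneralLinearGroup (Fin 2) K)) (hne : A.Nonempty)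
    (hsymm : (↑A : Set (Matrix.GeneralLinearGroup (Fin 2) K))⁻¹ = ↑A) :
    A.card ≤ (Fintype.card K - 1) *
      ((A ^ 2).filter fun g => Matrix.GeneralLinearGroup.det g = 1).card := by
  classical
  have _h := hne
  have hfib : ∀ e : Kˣ, (A.filter fun g => Matrix.GeneralLinearGroup.det g = e).card ≤
      ((A ^ 2).filter fun g => Matrix.GeneralLinearGroup.det g = 1).card := by
    intro e
    rcases (A.filter fun g => Matrix.GeneralLinearGroup.det g = e).eq_empty_or_nonempty with
      h0 | ⟨h₀, hh₀⟩
    · rw [h0, Finset.card_empty]; exact Nat.zero_le _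
    obtain ⟨hh₀A, hh₀e⟩ := Finset.mem_filter.1 hh₀
    have hinvA : h₀⁻¹ ∈ A := by
      have h : h₀⁻¹ ∈ (↑A : Set (Matrix.GeneralLinearGroup (Fin 2) K))⁻¹ := by
        rw [Set.mem_inv, inv_inv]; exact Finset.mem_coe.2 hh₀A
      rw [hsymm] at h
      exact Finset.mem_coe.1 h
    refine Finset.card_le_card_of_injOn (fun x => h₀⁻¹ * x) (fun x hx => ?_) ?_
    · obtain ⟨hxA, hxe⟩ := Finset.mem_filter.1 (Finset.mem_coe.1 hx)
      show h₀⁻¹ * x ∈ ((A ^ 2).filter fun g => Matrix.GeneralLinearGroup.det g = 1)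
      rw [Finset.mem_filter]
      refine ⟨?_, ?_⟩
      · rw [sq]; exact Finset.mul_mem_mul hinvA hxA
      · rw [map_mul, map_inv, hh₀e, hxe, inv_mul_cancel]
    · intro x _ y _ hxy
      exact mul_left_cancel hxy
  calc A.card = ∑ e : Kˣ, (A.filter fun g => Matrix.GeneralLinearGroup.det g = e).card :=
        Finset.card_eq_sum_card_fiberwise (fun x _ => Finset.mem_univ _)
    _ ≤ ∑ _e : Kˣ, ((A ^ 2).filter fun g => Matrix.GeneralLinearGroup.det g = 1).card :=
        Finset.sum_le_sum fun e _ => hfib e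
    _ = (Fintype.card K - 1) *
          ((A ^ 2).filter fun g => Matrix.GeneralLinearGroup.det g = 1).card := by
        rw [Finset.sum_const, Finset.card_univ, Fintype.card_units, smul_eq_mul]

end Summit.MatrixMultiplication.MatrixMultiplication.Theorems.GradedDesignFamily.Negative
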